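import Literature.Analysis.FluidPDE.LocalTypeIScaling
import Literature.Analysis.FluidPDE.SereginZajaczkowski2007
import Literature.Analysis.FluidPDE.SereginSverakBlowupSelection
import Literature.Analysis.FluidPDE.ClassicalSolutionRescale
import HarnessLib

/-!
# Route FrozenSignCascade · crux `BoundedEnvelopeContinuation` — stub AX1:
# axis decay `|x'| ‖w‖ ≤ C` on the unit Seregin–Šverák cylinder from the Albritton–Barker
# Type I quantity, given the single-shell sup bound

Helper file for the crux item stmt-NavierStokesRegularity-10579 (`BoundedEnvelopeContinuation`,
conjunct (B) of route `FrozenSignCascade`); lands `--supports` that item (stub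
`axisDecay_of_typeIBound`, AX1 of the axisymmetric support theorem).

Let `(w, ϖ)` be a classical solution of the unforced unit-viscosity system on `(-25, 0) × ℝ³`
with axisymmetric slices and `𝐈(Q((0,0),5)) < ∞` (Albritton–Barker's Type I quantity
`typeIBound`). Assume the single-shell sup bound (hypothesis, stub AX1s): every classical
axisymmetric `(W, P)` on `(-16, 0) × ℝ³` with `(A + C + D + E)(Q((0,0),4)) ≤ K` satisfies
`‖W‖ ≤ Ψ K` on the shell cylinder `𝒞(1,2;1) × ]-1,0[`. Then `|x'| ‖w(s, x)‖ ≤ (3/2) Ψ K` on the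
unit cylinder `Q = 𝒞 × ]-1, 0[`, `K = 𝐈(Q((0,0),5))`: for `(s, y) ∈ Q` off the axis, the
Navier–Stokes zoom about the axis point `(s₁, y₃ e₃)` with factor `μ = (2/3)|y'|` puts `y` on
the shell `|η'| = 3/2`, is again classical and axisymmetric, and its scaled sum on `Q((0,0),4)`
is the scaled sum of `(w, ϖ)` on `Q((s₁, y₃ e₃), 4μ) ⊆ Q((0,0),5)` (scale covariance
`abScaledSum_nsZoom`), hence `≤ K` (Seregin–Šverák 2009, Thm 3.1 / (r4), reduction to
Seregin–Zajaczkowski 2007, Prop. 4.1, by rescaling about axis points).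

## References

* G. Seregin, V. Šverák, *On Type I singularities of the local axi-symmetric solutions of the
  Navier–Stokes equations*, Comm. PDE 34 (2009) = arXiv:0804.1803, §3. [SereginSverak2009]
* G. Seregin, W. Zajaczkowski, *A sufficient condition of regularity for axially symmetric
  solutions to the Navier–Stokes equations*, SIAM J. Math. Anal. 39 (2007), Prop. 4.1.
  [SereginZajaczkowski2007]
* D. Albritton, T. Barker, J. Math. Fluid Mech. 21 (2019) = arXiv:1811.00502, §1.
  [AlbrittonBarker2019]
-/

noncomputable section

set_option linter.dupNamespace false -- nested layout Summit.<S>.<Sub>, Sub = S (D-0017)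

open Set MeasureTheory Filter Topology Metric Function
open scoped ENNReal NNReal
open Literature.Analysis Literature.Analysis.FluidPDE
open Literature.Analysis.FluidPDE.SereginSverak2009 Literature.Analysis.FluidPDE.SereginZajaczkowski2007

namespace Summit.NavierStokesRegularity.NavierStokesRegularity.Theorems.BoundedEnvelope

/-! ### The zoom and the Albritton–Barker scaled sum -/

/-- The gradient of the zoomed velocity `c u(t₀ + c² s, x₀ + c y)` is the zoomed gradient
`c² ∇u(t₀ + c² s, x₀ + c y)` (chain rule; no differentiability needed, both sides being junk
together). -/
theorem fderiv_nsZoom_eq (c t₀ : ℝ) (x₀ : EuclideanSpace ℝ (Fin 3))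
    (u : ℝ → EuclideanSpace ℝ (Fin 3) → EuclideanSpace ℝ (Fin 3)) :
    (fun t x => fderiv ℝ ((c • stPull (c ^ 2) c t₀ x₀ u) t) x) =
      c ^ 2 • stPull (c ^ 2) c t₀ x₀ (fun t x => fderiv ℝ (u t) x) := by
  funext t x
  rw [Pi.smul_apply, fderiv_const_smul_field, Pi.smul_apply, fderiv_stPull, smul_smul, ← sq]
  rfl

/-- The scaled sum of the zoom `c u(t₀ + c² ·, x₀ + c ·)` on `Q((0,0), r)` is at most
`𝐈(ω)` of `u` as soon as `Q((t₀, x₀), c r) ⊆ ω` (scale covariance `abScaledSum_nsZoom`). -/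
theorem abScaledSum_nsZoom_le {c r : ℝ} (hc : 0 < c) (hr : 0 < r) (t₀ : ℝ)
    (x₀ : EuclideanSpace ℝ (Fin 3))
    (u : ℝ → EuclideanSpace ℝ (Fin 3) → EuclideanSpace ℝ (Fin 3))
    (q : ℝ → EuclideanSpace ℝ (Fin 3) → ℝ) {ω : Set (ℝ × EuclideanSpace ℝ (Fin 3))}
    (hω : parabolicCylinder (c * r) (t₀, x₀) ⊆ ω) :
    abScaledSum r ((0 : ℝ), (0 : EuclideanSpace ℝ (Fin 3))) (c • stPull (c ^ 2) c t₀ x₀ u)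
        (c ^ 2 • stPull (c ^ 2) c t₀ x₀ q)
        (fun t x => fderiv ℝ ((c • stPull (c ^ 2) c t₀ x₀ u) t) x) ≤
      typeIBound ω u q (fun t x => fderiv ℝ (u t) x) := by
  rw [fderiv_nsZoom_eq, abScaledSum_nsZoom hc hr t₀ x₀]
  refine abScaledSum_le_typeIBound (mul_pos hc hr) ?_
  simpa using hω

/-- `Q((t₀, b e₃), R) ⊆ Q((0,0), 5)` when `-25 + R² ≤ t₀ ≤ 0` and `|b| + R ≤ 5`. -/
theorem parabolicCylinder_axis_subset {t₀ b R : ℝ} (ht₀ : t₀ ≤ 0) (ht : -25 + R ^ 2 ≤ t₀)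
    (hb : |b| + R ≤ 5) :
    parabolicCylinder R (t₀, b • (eZ : EuclideanSpace ℝ (Fin 3))) ⊆
      parabolicCylinder 5 ((0 : ℝ), (0 : EuclideanSpace ℝ (Fin 3))) := by
  rintro ⟨t, x⟩ hq
  rw [mem_parabolicCylinder] at hq ⊢
  obtain ⟨⟨h1, h2⟩, h3⟩ := hq
  have hbe : ‖b • (eZ : EuclideanSpace ℝ (Fin 3))‖ = |b| := by
    rw [norm_smul, Real.norm_eq_abs, eZ, PiLp.norm_single, norm_one, mul_one]
  have hx : ‖x‖ ≤ ‖x - b • eZ‖ + ‖b • (eZ : EuclideanSpace ℝ (Fin 3))‖ := norm_le_norm_sub_add x _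
  rw [dist_eq_norm] at h3
  simp only [dist_zero_right]
  refine ⟨⟨by linarith, by linarith⟩, ?_⟩
  linarith

/-! ### The axis-centred zoom of an axisymmetric classical solution -/

/-- The zoom `μ w(s₁ + μ² ·, b e₃ + μ ·)` of a classical solution on `(-25, 0)` is classical on
`(-16, 0)` when `μ² ≤ 4/9` and `-1 ≤ s₁ ≤ 0`. -/
theorem zoom_isClassical {w : ℝ → EuclideanSpace ℝ (Fin 3) → EuclideanSpace ℝ (Fin 3)}
    {ϖ : ℝ → EuclideanSpace ℝ (Fin 3) → ℝ}
    (hw : IsClassicalNSSolutionOn (Ioo (-25) 0) 1 0 w ϖ) {μ s₁ : ℝ} (hμ : 0 < μ)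
    (hμ2 : μ ^ 2 ≤ 4 / 9) (hs₁ : s₁ ≤ 0) (hs₁' : -1 ≤ s₁) (x₀ : EuclideanSpace ℝ (Fin 3)) :
    IsClassicalNSSolutionOn (Ioo (-16) 0) 1 0 (μ • stPull (μ ^ 2) μ s₁ x₀ w)
      (μ ^ 2 • stPull (μ ^ 2) μ s₁ x₀ ϖ) := by
  refine (hw.nsRescale_translate_zero hμ s₁ x₀).mono ?_ (uniqueDiffOn_Ioo _ _)
  intro r hr
  simp only [mem_preimage, mem_Ioo] at hr ⊢
  obtain ⟨hr1, hr2⟩ := hr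
  have hμ2pos : 0 < μ ^ 2 := by positivity
  constructor
  · nlinarith
  · nlinarith

/-- The slices of the axis-centred zoom of an axisymmetric solution are axisymmetric. -/
theorem zoom_isAxisymmetric' {w : ℝ → EuclideanSpace ℝ (Fin 3) → EuclideanSpace ℝ (Fin 3)}
    (haxi : ∀ t ∈ Ioo (-25 : ℝ) 0, IsAxisymmetric (w t)) {μ s₁ : ℝ} (hμ : 0 < μ)
    (hμ2 : μ ^ 2 ≤ 4 / 9) (hs₁ : s₁ ≤ 0) (hs₁' : -1 ≤ s₁) (b : ℝ) :
    ∀ t ∈ Ioo (-16 : ℝ) 0, IsAxisymmetric ((μ • stPull (μ ^ 2) μ s₁ (b • eZ) w) t) := by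
  intro t ht
  obtain ⟨ht1, ht2⟩ := ht
  have hμ2pos : 0 < μ ^ 2 := by positivity
  have hmem : s₁ + μ ^ 2 * t ∈ Ioo (-25 : ℝ) 0 := ⟨by nlinarith, by nlinarith⟩
  exact isAxisymmetric_rescale (haxi _ hmem) μ b μ

/-! ### The main estimate -/

/-- Core of AX1: off the axis, `|y'| ‖w(s, y)‖ ≤ (3/2) Ψ K` for `(s, y)` in the unit cylinder,
by the zoom about `(s₁, y₃ e₃)` with factor `μ = (2/3)|y'|`. -/
theorem axisDecay_core {Ψ : ℝ≥0 → ℝ≥0}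
    (hΨ : ∀ (W : ℝ → EuclideanSpace ℝ (Fin 3) → EuclideanSpace ℝ (Fin 3))
      (P : ℝ → EuclideanSpace ℝ (Fin 3) → ℝ),
      IsClassicalNSSolutionOn (Set.Ioo (-16) 0) 1 0 W P →
      (∀ t ∈ Set.Ioo (-16 : ℝ) 0, IsAxisymmetric (W t)) →
      ∀ K : ℝ≥0, abScaledSum 4 ((0 : ℝ), (0 : EuclideanSpace ℝ (Fin 3))) W P
          (fun t x => fderiv ℝ (W t) x) ≤ K →
        ∀ z ∈ shellCyl 1 2 1 1, ‖W z.1 z.2‖ ≤ Ψ K)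
    {w : ℝ → EuclideanSpace ℝ (Fin 3) → EuclideanSpace ℝ (Fin 3)}
    {ϖ : ℝ → EuclideanSpace ℝ (Fin 3) → ℝ}
    (hw : IsClassicalNSSolutionOn (Set.Ioo (-25) 0) 1 0 w ϖ)
    (haxi : ∀ t ∈ Set.Ioo (-25 : ℝ) 0, IsAxisymmetric (w t)) {K : ℝ≥0}
    (hK : typeIBound (parabolicCylinder 5 ((0 : ℝ), (0 : EuclideanSpace ℝ (Fin 3)))) w ϖ
      (fun t x => fderiv ℝ (w t) x) ≤ K)
    {s : ℝ} {y : EuclideanSpace ℝ (Fin 3)} (hs1 : -1 < s) (hs2 : s < 0)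
    (hρ1 : cylRadius y < 1) (hρ0 : 0 < cylRadius y) (hy2 : |y 2| < 1) :
    cylRadius y * ‖w s y‖ ≤ 3 / 2 * Ψ K := by
  -- the zoom parameters
  obtain ⟨μ, hμ⟩ : ∃ μ : ℝ, μ = cylRadius y / (3 / 2) := ⟨_, rfl⟩
  have hμpos : 0 < μ := by rw [hμ]; positivity
  have hμlt : μ < 2 / 3 := by rw [hμ]; linarith
  have hμ2pos : 0 < μ ^ 2 := by positivity
  have hμ2 : μ ^ 2 ≤ 4 / 9 := by nlinarith
  obtain ⟨s₁, hs₁⟩ : ∃ s₁ : ℝ, s₁ = min 0 (s + μ ^ 2 / 2) := ⟨_, rfl⟩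
  have hs₁0 : s₁ ≤ 0 := hs₁ ▸ min_le_left _ _
  have hs₁s : s₁ ≤ s + μ ^ 2 / 2 := hs₁ ▸ min_le_right _ _
  have hss₁ : s < s₁ := hs₁ ▸ lt_min hs2 (by linarith)
  have hs₁1 : -1 ≤ s₁ := by linarith
  obtain ⟨σ, hσ⟩ : ∃ σ : ℝ, σ = (s - s₁) / μ ^ 2 := ⟨_, rfl⟩
  have hσ0 : σ < 0 := by rw [hσ]; exact div_neg_of_neg_of_pos (by linarith) hμ2pos
  have hσ1 : -1 < σ := by
    rw [hσ, lt_div_iff₀ hμ2pos]; linarith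
  have hσs : s₁ + μ ^ 2 * σ = s := by rw [hσ]; field_simp; ring
  set b : ℝ := y 2 with hb
  -- the zoomed pair
  set W : ℝ → EuclideanSpace ℝ (Fin 3) → EuclideanSpace ℝ (Fin 3) :=
    μ • stPull (μ ^ 2) μ s₁ (b • eZ) w with hW
  set P : ℝ → EuclideanSpace ℝ (Fin 3) → ℝ := μ ^ 2 • stPull (μ ^ 2) μ s₁ (b • eZ) ϖ with hP
  have hWsol : IsClassicalNSSolutionOn (Set.Ioo (-16) 0) 1 0 W P :=
    zoom_isClassical hw hμpos hμ2 hs₁0 hs₁1 (b • eZ)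
  have hWaxi : ∀ t ∈ Set.Ioo (-16 : ℝ) 0, IsAxisymmetric (W t) :=
    zoom_isAxisymmetric' haxi hμpos hμ2 hs₁0 hs₁1 b
  have hsub : parabolicCylinder (μ * 4) (s₁, b • (eZ : EuclideanSpace ℝ (Fin 3))) ⊆
      parabolicCylinder 5 ((0 : ℝ), (0 : EuclideanSpace ℝ (Fin 3))) := by
    refine parabolicCylinder_axis_subset hs₁0 (by nlinarith) ?_
    have : |b| < 1 := hy2
    nlinarith
  have hWK : abScaledSum 4 ((0 : ℝ), (0 : EuclideanSpace ℝ (Fin 3))) W P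
      (fun t x => fderiv ℝ (W t) x) ≤ K :=
    (abScaledSum_nsZoom_le hμpos (by norm_num : (0 : ℝ) < 4) s₁ (b • eZ) w ϖ hsub).trans hK
  -- the shell point
  set η : EuclideanSpace ℝ (Fin 3) := μ⁻¹ • (y - b • eZ) with hη
  have hyb : cylRadius (y - b • (eZ : EuclideanSpace ℝ (Fin 3))) = cylRadius y := by
    rw [sub_eq_add_neg, ← neg_smul, add_comm, cylRadius_smul_eZ_add]
  have hηrad : cylRadius η = 3 / 2 := by
    rw [hη, cylRadius_smul, hyb, abs_of_pos (inv_pos.2 hμpos), hμ]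
    field_simp
  have hη2 : η 2 = 0 := by
    simp [hη, hb, eZ]
  have hmem : ((σ, η) : ℝ × EuclideanSpace ℝ (Fin 3)) ∈ shellCyl 1 2 1 1 := by
    rw [mem_shellCyl]
    refine ⟨⟨by norm_num; linarith, hσ0⟩, ⟨by simp only [hηrad]; norm_num,
      by simp only [hηrad]; norm_num⟩, ?_⟩
    simp only [hη2, abs_zero]
    norm_num
  have hbound : ‖W σ η‖ ≤ Ψ K := hΨ W P hWsol hWaxi K hWK (σ, η) hmem
  have hWval : W σ η = μ • w s y := by
    rw [hW, smul_stPull_apply, hσs, hη, smul_smul, mul_inv_cancel₀ hμpos.ne', one_smul,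
      add_sub_cancel]
  rw [hWval, norm_smul, Real.norm_of_nonneg hμpos.le] at hbound
  calc cylRadius y * ‖w s y‖ = 3 / 2 * (μ * ‖w s y‖) := by rw [hμ]; ring
    _ ≤ 3 / 2 * Ψ K := by gcongr

/-- **AX1: axis decay (r4) on the unit Seregin–Šverák cylinder from the Albritton–Barker Type I
quantity on `Q((0,0),5)`, given the single-shell sup bound AX1s.** For a classical axisymmetric
solution `(w, ϖ)` of the unforced unit-viscosity system on `(-25, 0) × ℝ³` with
`𝐈(Q((0,0),5)) < ∞` one has `|x'| ‖w(s, x)‖ ≤ C` on `Q = 𝒞 × ]-1, 0[`, with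
`C = (3/2) Ψ(𝐈(Q((0,0),5)))` (Seregin–Šverák 2009, §3, (r4), by rescaling the single-shell
bound of Seregin–Zajaczkowski 2007, Prop. 4.1, about axis points). -/
theorem axisDecay_of_typeIBound : (∃ Ψ : ℝ≥0 → ℝ≥0, Monotone Ψ ∧ ∀ (W : ℝ → EuclideanSpace ℝ (Fin 3) → EuclideanSpace ℝ (Fin 3)) (P : ℝ → EuclideanSpace ℝ (Fin 3) → ℝ), Literature.Analysis.FluidPDE.IsClassicalNSSolutionOn (Set.Ioo (-16) 0) 1 0 W P → (∀ t ∈ Set.Ioo (-16 : ℝ) 0, Literature.Analysis.FluidPDE.IsAxisymmetric (W t)) → ∀ K : ℝ≥0, Literature.Analysis.FluidPDE.abScaledSum 4 ((0 : ℝ), (0 : EuclideanSpace ℝ (Fin 3))) W P (fun t x => fderiv ℝ (W t) x) ≤ K → ∀ z ∈ Literature.Analysis.FluidPDE.SereginZajaczkowski2007.shellCyl 1 2 1 1, ‖W z.1 z.2‖ ≤ Ψ K) → ∀ (w : ℝ → EuclideanSpace ℝ (Fin 3) → EuclideanSpace ℝ (Fin 3)) (ϖ : ℝ → EuclideanSpace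 ℝ (Fin 3) → ℝ), Literature.Analysis.FluidPDE.IsClassicalNSSolutionOn (Set.Ioo (-25) 0) 1 0 w ϖ → (∀ t ∈ Set.Ioo (-25 : ℝ) 0, Literature.Analysis.FluidPDE.IsAxisymmetric (w t)) → Literature.Analysis.FluidPDE.typeIBound (Literature.Analysis.FluidPDE.parabolicCylinder 5 ((0 : ℝ), (0 : EuclideanSpace ℝ (Fin 3)))) w ϖ (fun t x => fderiv ℝ (w t) x) < ⊤ → ∃ C : ℝ, ∀ z ∈ Literature.Analysis.FluidPDE.SereginSverak2009.parCyl 0 1, Literature.Analysis.FluidPDE.cylRadius z.2 * ‖w z.1 z.2‖ ≤ C := by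
  rintro ⟨Ψ, -, hΨ⟩ w ϖ hw haxi hI
  set K : ℝ≥0 := (typeIBound (parabolicCylinder 5 ((0 : ℝ), (0 : EuclideanSpace ℝ (Fin 3)))) w ϖ
    (fun t x => fderiv ℝ (w t) x)).toNNReal with hKdef
  have hK : typeIBound (parabolicCylinder 5 ((0 : ℝ), (0 : EuclideanSpace ℝ (Fin 3)))) w ϖ
      (fun t x => fderiv ℝ (w t) x) ≤ K :=
    (ENNReal.coe_toNNReal hI.ne).ge
  refine ⟨3 / 2 * Ψ K, ?_⟩
  rintro ⟨s, y⟩ hz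
  rw [mem_parCyl_zero] at hz
  obtain ⟨⟨hs1, hs2⟩, hρ1, hy2⟩ := hz
  dsimp only at hs1 hs2 hρ1 hy2 ⊢
  rcases (cylRadius_nonneg y).eq_or_lt with hρ0 | hρ0
  · rw [← hρ0, zero_mul]; positivity
  · exact axisDecay_core hΨ hw haxi hK (by linarith) hs2 hρ1 hρ0 hy2

end Summit.NavierStokesRegularity.NavierStokesRegularity.Theorems.BoundedEnvelope

end
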